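import Mathlib.Algebra.MonoidAlgebra.Grading
import Mathlib.Algebra.MonoidAlgebra.MapDomain
import Mathlib.Algebra.MonoidAlgebra.Basic
import Mathlib.RingTheory.GradedAlgebra.Homogeneous.Ideal
import Mathlib.RingTheory.Ideal.Maps
import Mathlib.RingTheory.Ideal.Quotient.Operations
import Literature.AlgebraicGeometry.Tropical.InitialIdeal
import HarnessLib

/-!
# Tropical links: the torus-factor splitting `in_w(U) ≅ T_σ × Y_σ` of an initial degeneration

Definition item `defn-TropicalLink` (topic `Literature/AlgebraicGeometry/Tropical`), requested by
route `ResolutionOfSingularities/TropicalLinks` (crux `InductiveStep`), which needs, for a prime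
ideal `I ⊆ k[x_1^±, …, x_N^±] = AddMonoidAlgebra k (Fin N → ℤ)` (`U = V(I) ⊆ 𝔾_m^N`) and a
weight `w` in the relative interior of an `r`-dimensional cone `σ` of the Gröbner fan of `I`, the
variety `Y_σ` ("the link") with `in_w(U) ≅ T_σ × Y_σ`, `Y_σ ⊆ 𝔾_m^{N-r}` closed, defined up to
the choice of a splitting of the lattice.

## The printed mathematics

* Tevelev (AJM 2007 = arXiv:math/0412329), §1, p. 1088 (read): "Let `T_X` be the normalizer of `X`
  in `T`. The action of `T_X` on `T` (and hence on `X`) is free and the quotient `X/T_X` is a closed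
  subvariety of a torus `T/T_X`. … `X ≃ (X/T_X) × T_X`."
* Katz, *A tropical toolkit* (Expo. Math. 2009 = arXiv:math/0610878), §5 "Degenerations" (read):
  the Gröbner complex; Lemma "if `w` is in the relative interior of a `k`-dimensional cell of the
  Gröbner complex of `X` then the closed subscheme `in_w X` is invariant under a `k`-dimensional
  torus"; Lemma "`in_u(in_w X) = in_{w+εu} X` for `ε > 0` sufficiently small"; §6 "Tropical
  varieties" (read): Lemma "`Trop(in_w X)` is the star of `τ` in `Trop(X)`" (`w ∈ τ`), and the proof
  of "`X` purely `d`-dimensional ⇒ `Trop(X)` purely `d`-dimensional" ("since `in_w X` is a flat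
  deformation of `X`, it is also `d`-dimensional"; `in_w X ∩ (k^*)^n` is invariant under the torus
  `H` with `H^∨_ℝ = Span(C_Γ − w)`).
* Maclagan–Sturmfels, *Introduction to Tropical Geometry* (2015), §2.4–2.6 and §3.3 (homogeneity
  of `in_w(I)` with respect to the linear span of the cell of `w`; `in_w(X) ≅` torus × variety;
  the book is not held on this hub — acquisition request acq-06520 of file `InitialIdeal` — and no
  statement number from it is relied upon here).

Invariance of a closed subscheme `V(J) ⊆ T = Spec k[M]` under a subtorus `T' ⊆ T` with character
lattice `M ↠ L'` is, on ideals, HOMOGENEITY of `J` for the `L'`-grading `deg x^m = (image of m)`;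
for a one-parameter subgroup `t ↦ t^{w'}` of `𝔾_m^N` it is homogeneity for the `ℤ`-grading
`deg x^v = ⟨w', v⟩`, which is the same as `in_{w'}(J) = J`
(`isHomogeneous_gradeBy_iff_initialIdeal_eq`, proved here). This file therefore speaks Mathlib's
graded language (`Ideal.IsHomogeneous (AddMonoidAlgebra.gradeBy k φ) J`) and the tree's initial
ideals (`initialIdeal`, `weightInitialIdeal` of file `InitialIdeal`) interchangeably.

## What is defined

* `linkIdeal ι J` — for a map of exponent lattices `ι : L →+ M` and an ideal `J ⊆ k[M]`: the ideal
  `k[ι]⁻¹ J` of `k[L]` (`= J ∩ k[L]` for a sublattice); `V(linkIdeal ι J)` is the closed image of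
  `V(J)` in the quotient torus `Spec k[L]`.
* `splitLinkIdeal e J`, `TropicalLink e J` — for a SPLITTING `e : M ≃+ L' × L` of the exponent
  lattice (for `M = ℤ^N`: a unimodular change of coordinates `(x, y)`, `x = (x_1..x_r)`,
  `y = (y_1..y_{N-r})`): the ideal `k[e](J) ∩ k[L]` of `k[L] = k[y^±]` and the ring
  `TropicalLink e J = k[L] ⧸ splitLinkIdeal e J` — the coordinate ring of the closed image `Y` of
  `V(J)` in the quotient torus `Spec k[L]`, which is `V(J)/T'` when `V(J)` is invariant under the
  subtorus `T' = Spec k[L']` with character lattice `M ↠ L'`. For `J = in_w(I)` and `e`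
  adapted to the Gröbner cone `σ ∋ w` (second factor `L = σ^⊥ ∩ ℤ^N`, equivalently: the first `r`
  coordinate functionals of `e` lie in the homogeneity lattice of `in_w(I)`), `Spec (TropicalLink e
  (in_w I))` is the variety `Y_σ` of the route.
* `homogeneityLattice J ≤ ℤ^N` — the weights `w'` with `in_{w'}(J) = J` (an `AddSubgroup`: closure
  under `+` is the joint-homogeneity lemma); for `J = in_w(I)`, `w ∈ relint σ`, this is
  `span(σ) ∩ ℤ^N` by Katz's lemma `in_u(in_w I) = in_{w+εu}(I)` (not proved here), so that
  `r = dim σ` is its rank.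
* `dotWeightHom w` (`⟨w, ·⟩` as `→+`), `splitQuotientMap` (the comparison map).

## What is proved (sorry-free)

* `decompose_gradeBy_coe` — homogeneous components for `gradeBy k φ` are coefficient filters;
  `isHomogeneous_gradeBy_comp` (coarsening), `isHomogeneous_gradeBy_prod`,
  `isHomogeneous_gradeBy_of_forall_eval` (JOINT homogeneity for finitely many weights),
  `isHomogeneous_map_domCongr` (transport under a monomial change of coordinates).
* `isHomogeneous_gradeBy_iff_initialIdeal_eq` : `J.IsHomogeneous (gradeBy k φ) ↔ in_φ(J) = J`, and
  its integer-weight form `weightInitialIdeal_eq_self_iff`.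
* **Torus-factor splitting** (Tevelev's `X ≃ (X/T_X) × T_X` for a split subtorus, at the level of
  ideals and coordinate rings): for `J ⊆ k[L' × L]` homogeneous for the `L'`-grading,
  `map_linkIdeal_inr_eq : J = ⟨k[inr](linkIdeal inr J)⟩` and
  `quotientEquivOfIsHomogeneous : k[L' × L] ⧸ J ≃ₐ[k] (k[L] ⧸ linkIdeal inr J)[L']`; for a general
  lattice with a splitting `e`, `quotientEquivTropicalLink : k[M] ⧸ J ≃ₐ[k] (TropicalLink e J)[L']`
  under `J.IsHomogeneous (gradeBy k (fst ∘ e))`, a hypothesis supplied from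
  `in_{w'_i}(J) = J` (`i < r`) by `isHomogeneous_gradeBy_pi_of_forall_weightInitialIdeal_eq`.
* small API: `mem_linkIdeal_iff`, `linkIdeal_mono/top/ne_top/isPrime`, `mem_splitLinkIdeal_iff`,
  `splitLinkIdeal_eq_linkIdeal`, `splitQuotientMap_single/surjective`, `ker_splitQuotientMap`.

## What is NOT here (no named fact is introduced)

The two FACTS the route also asked for are statements about the Gröbner fan and the tropical
variety as polyhedral objects, which the tree does not have yet (cf. the module docstrings of
`InitialIdeal` and `SchonIdeal`): (1) `dim Y_σ = d − r` for `I` prime of dimension `d` and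
`w ∈ relint σ`, `dim σ = r` — it combines "`w ↦ in_w(I)` is constant exactly on the relatively open
cones of a finite fan and `in_w(I)` is homogeneous exactly for `span(σ) ∩ ℤ^N`" (Gröbner fan;
Katz §5) with "a flat (Gröbner) degeneration of an irreducible `d`-dimensional `U` is
equidimensional of dimension `d`" (Katz §6, proof of the dimension proposition) and the splitting
proved here (`dim (Y × 𝔾_m^r) = dim Y + r`); (2) `Trop(Y_σ) = Star_{Trop U}(σ) / span σ`
(Katz §6, Lemma "`Trop(in_w X)` is the star"). Both should be vendored as cite facts, stated through
`homogeneityLattice`, `TropicalLink` and a `Trop` object, once the Gröbner-fan material is in the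
tree; they are deliberately not approximated here.

## References

* J. Tevelev, *Compactifications of subvarieties of tori*, Amer. J. Math. 129 (2007) 1087–1104
  (arXiv:math/0412329), §1. [Tevelev2007]
* E. Katz, *A tropical toolkit*, Expo. Math. 27 (2009) 1–36 (arXiv:math/0610878), §5, §6.
  [Katz2009TropicalToolkit]
* D. Maclagan, B. Sturmfels, *Introduction to Tropical Geometry*, GSM 161, AMS 2015, §2.4–2.6, §3.3.
  [MaclaganSturmfels2015]
-/

noncomputable section

open AddMonoidAlgebra DirectSum

namespace Literature.AlgebraicGeometry.Tropical

universe u v w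

/-! ### Homogeneous components for a weight grading -/

section Decompose

variable {k : Type u} [CommSemiring k] {M : Type v} [AddMonoid M] {Λ : Type w} [AddMonoid Λ]
  [DecidableEq Λ]

/-- For the grading of `k[M]` by an additive weight map `φ : M →+ Λ` (Mathlib's
`AddMonoidAlgebra.gradeBy k φ`), the degree-`i` homogeneous component of `f` is the sum of the
terms of `f` whose exponent has weight `i`. [folklore] -/
theorem decompose_gradeBy_coe (φ : M →+ Λ) (f : AddMonoidAlgebra k M) (i : Λ) :
    ((decompose (gradeBy k φ) f i : gradeBy k φ i) : AddMonoidAlgebra k M) =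
      ofCoeff (f.coeff.filter fun m => φ m = i) := by
  induction f using AddMonoidAlgebra.induction_linear with
  | zero =>
    rw [decompose_zero, DirectSum.zero_apply, Submodule.coe_zero, coeff_zero, Finsupp.filter_zero,
      ofCoeff_zero]
  | add x y hx hy =>
    rw [decompose_add, DirectSum.add_apply, Submodule.coe_add, hx, hy, coeff_add,
      Finsupp.filter_add, ofCoeff_add]
  | single m r =>
    rw [GradesBy.decompose_single, coeff_single]
    by_cases h : φ m = i
    · subst h
      rw [DirectSum.of_eq_same, Finsupp.filter_single_of_pos (fun m' => φ m' = φ m) rfl]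
      rfl
    · rw [DirectSum.of_eq_of_ne _ _ _ (Ne.symm h), Submodule.coe_zero,
        Finsupp.filter_single_of_neg (fun m' => φ m' = i) h, ofCoeff_zero]

omit [DecidableEq Λ] in
/-- Membership in a weight-graded piece: all exponents have the given weight. [folklore] -/
theorem mem_gradeBy_iff_forall (φ : M →+ Λ) (i : Λ) (f : AddMonoidAlgebra k M) :
    f ∈ gradeBy k φ i ↔ ∀ m ∈ f.coeff.support, φ m = i :=
  Iff.rfl

/-- A homogeneous ideal for the grading `φ` is homogeneous for every COARSER grading `g ∘ φ`
(`g : Λ →+ Λ'` additive): a subtorus-invariant subscheme is invariant under its subtori.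
[folklore] -/
theorem isHomogeneous_gradeBy_comp {Λ' : Type*} [AddMonoid Λ'] [DecidableEq Λ']
    {φ : M →+ Λ} {J : Ideal (AddMonoidAlgebra k M)} (hJ : J.IsHomogeneous (gradeBy k φ))
    (g : Λ →+ Λ') : J.IsHomogeneous (gradeBy k (g.comp φ)) := by
  rw [Ideal.IsHomogeneous.iff_exists] at hJ
  obtain ⟨S, rfl⟩ := hJ
  refine Ideal.homogeneous_span (gradeBy k (g.comp φ)) _ ?_
  rintro _ ⟨s, -, rfl⟩
  obtain ⟨i, hi⟩ := s.2
  exact ⟨g i, fun m hm => by rw [AddMonoidHom.comp_apply, hi m hm]⟩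

/-- Iterated filters. [folklore] -/
private theorem filter_filter {α : Type*} {R : Type*} [Zero R] (f : α →₀ R) (p q : α → Prop)
    [DecidablePred p] [DecidablePred q] :
    (f.filter p).filter q = f.filter fun a => p a ∧ q a := by
  ext a
  simp only [Finsupp.filter_apply]
  by_cases hp : p a <;> by_cases hq : q a <;> simp [hp, hq]

/-- Filters along equivalent predicates agree. [folklore] -/
private theorem filter_congr_pred {α : Type*} {R : Type*} [Zero R] (f : α →₀ R) {p q : α → Prop}
    [DecidablePred p] [DecidablePred q] (h : ∀ a, p a ↔ q a) : f.filter p = f.filter q := by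
  ext a
  simp only [Finsupp.filter_apply]
  by_cases hp : p a
  · rw [if_pos hp, if_pos ((h a).1 hp)]
  · rw [if_neg hp, if_neg (mt (h a).2 hp)]

/-- **Joint homogeneity.** An ideal homogeneous for each coordinate weight `m ↦ Φ m i` of a weight
map `Φ : M →+ Λ^ι'` (`ι'` finite) is homogeneous for the joint `Λ^ι'`-grading by `Φ`: a subscheme
invariant under each of finitely many commuting one-parameter subgroups is invariant under the
subtorus they generate. [folklore] -/
theorem isHomogeneous_gradeBy_of_forall_eval {ι' : Type*} [Fintype ι']
    [DecidableEq ι'] (Φ : M →+ (ι' → Λ)) {J : Ideal (AddMonoidAlgebra k M)}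
    (h : ∀ i, J.IsHomogeneous (gradeBy k ((Pi.evalAddMonoidHom (fun _ : ι' => Λ) i).comp Φ))) :
    J.IsHomogeneous (gradeBy k Φ) := by
  classical
  intro c f hf
  rw [decompose_gradeBy_coe]
  suffices H : ∀ s : Finset ι', ofCoeff (f.coeff.filter fun m => ∀ i ∈ s, Φ m i = c i) ∈ J by
    rw [filter_congr_pred f.coeff (q := fun m => ∀ i ∈ (Finset.univ : Finset ι'), Φ m i = c i)
      (fun m => by simp [funext_iff])]
    exact H Finset.univ
  intro s
  induction s using Finset.induction_on with
  | empty =>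
    rw [filter_congr_pred f.coeff (q := fun _ => True) (fun m => by simp),
      (Finsupp.filter_eq_self_iff _ _).2 fun _ _ => trivial, ofCoeff_coeff]
    exact hf
  | insert i s hi ih =>
    have step := h i (c i) ih
    rw [decompose_gradeBy_coe, coeff_ofCoeff, filter_filter] at step
    rw [filter_congr_pred f.coeff (q := fun m => (∀ j ∈ s, Φ m j = c j) ∧
      ((Pi.evalAddMonoidHom (fun _ : ι' => Λ) i).comp Φ) m = c i)
      (fun m => by simp [and_comm])]
    exact step

/-- **Joint homogeneity, two weights.** Homogeneous for `φ₁` and for `φ₂` implies homogeneous for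
the joint grading `(φ₁, φ₂) : M →+ Λ × Λ₂`. [folklore] -/
theorem isHomogeneous_gradeBy_prod {Λ₂ : Type*} [AddMonoid Λ₂]
    [DecidableEq Λ₂] {φ₁ : M →+ Λ} {φ₂ : M →+ Λ₂} {J : Ideal (AddMonoidAlgebra k M)}
    (h₁ : J.IsHomogeneous (gradeBy k φ₁)) (h₂ : J.IsHomogeneous (gradeBy k φ₂)) :
    J.IsHomogeneous (gradeBy k (φ₁.prod φ₂)) := by
  classical
  rintro ⟨c₁, c₂⟩ f hf
  rw [decompose_gradeBy_coe]
  have step := h₂ c₂ (h₁ c₁ hf)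
  rw [decompose_gradeBy_coe, decompose_gradeBy_coe, coeff_ofCoeff, filter_filter] at step
  rw [filter_congr_pred f.coeff (q := fun m => φ₁ m = c₁ ∧ φ₂ m = c₂)
    (fun m => by simp [AddMonoidHom.prod_apply, Prod.ext_iff])]
  exact step

end Decompose

/-! ### Homogeneity of an ideal in a weight direction = invariance of the initial ideal -/

section Bridge

variable {k : Type u} [CommSemiring k] {M : Type v} [AddMonoid M] {Λ : Type w} [AddMonoid Λ]
  [LinearOrder Λ]

/-- The initial form `in_φ(f)` is the homogeneous component of `f` of MINIMAL weight: if `m₀` is an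
exponent of `f` of minimal weight, `in_φ(f)` is the degree-`φ m₀` component of `f`. [folklore] -/
theorem initialForm_eq_decompose (φ : M →+ Λ) {f : AddMonoidAlgebra k M} {m₀ : M}
    (hm₀ : m₀ ∈ f.coeff.support) (hmin : ∀ u ∈ f.coeff.support, φ m₀ ≤ φ u) :
    initialForm φ f = ((decompose (gradeBy k φ) f (φ m₀) : gradeBy k φ (φ m₀)) :
      AddMonoidAlgebra k M) := by
  rw [decompose_gradeBy_coe]
  unfold initialForm
  congr 1
  ext v
  rw [Finsupp.filter_apply, Finsupp.filter_apply]
  by_cases hv : v ∈ f.coeff.support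
  · have hiff : (∀ u ∈ f.coeff.support, φ v ≤ φ u) ↔ φ v = φ m₀ :=
      ⟨fun h => le_antisymm (h m₀ hm₀) (hmin v hv), fun h u hu => h ▸ hmin u hu⟩
    simp only [hiff]
  · rw [Finsupp.notMem_support_iff.1 hv]
    simp

/-- An initial form is homogeneous for the weight grading. [folklore] -/
theorem isHomogeneousElem_initialForm (φ : M →+ Λ) (f : AddMonoidAlgebra k M) :
    SetLike.IsHomogeneousElem (gradeBy k φ) (initialForm φ f) := by
  by_cases h : (initialForm φ f).coeff.support.Nonempty
  · obtain ⟨m₀, hm₀⟩ := h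
    exact ⟨φ m₀, fun m hm => weight_eq_of_mem_support_initialForm φ f hm hm₀⟩
  · rw [Finset.not_nonempty_iff_eq_empty, Finsupp.support_eq_empty, coeff_eq_zero] at h
    rw [h]
    exact ⟨0, Submodule.zero_mem _⟩

/-- **Homogeneity = invariance of the initial ideal.** An ideal `J ⊆ k[M]` is homogeneous for the
grading by the weight map `φ : M →+ Λ` (Mathlib: `J.IsHomogeneous (AddMonoidAlgebra.gradeBy k φ)`,
i.e. `J` contains the homogeneous components of its elements; geometrically, for `Λ = ℤ`: `V(J)`
is invariant under the one-parameter subgroup `λ_φ` of the torus) if and only if `in_φ(J) = J`.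
[folklore] -/
theorem isHomogeneous_gradeBy_iff_initialIdeal_eq (φ : M →+ Λ) (J : Ideal (AddMonoidAlgebra k M)) :
    J.IsHomogeneous (gradeBy k φ) ↔ initialIdeal φ J = J := by
  classical
  constructor
  · intro hJ
    apply le_antisymm
    · -- `in_φ(J) ≤ J`: the initial form of `f ∈ J` is a homogeneous component of `f`.
      unfold initialIdeal
      rw [Ideal.span_le]
      rintro _ ⟨f, hf, rfl⟩
      rw [SetLike.mem_coe]
      by_cases h0 : f.coeff.support.Nonempty
      · obtain ⟨m₀, hm₀, hmin⟩ := f.coeff.support.exists_min_image φ h0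
        rw [initialForm_eq_decompose φ hm₀ hmin]
        exact hJ _ hf
      · rw [Finset.not_nonempty_iff_eq_empty, Finsupp.support_eq_empty, coeff_eq_zero] at h0
        rw [h0, initialForm_zero]
        exact J.zero_mem
    · -- `J ≤ in_φ(J)`: `f ∈ J` is the sum of its homogeneous components, which lie in `J` and are
      -- their own initial forms.
      intro f hf
      rw [← DirectSum.sum_support_decompose (gradeBy k φ) f]
      refine Ideal.sum_mem _ fun i _ => ?_
      set c : gradeBy k φ i := decompose (gradeBy k φ) f i with hc_def
      have hc : (c : AddMonoidAlgebra k M) ∈ J := hJ i hf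
      have hhom : initialForm φ (c : AddMonoidAlgebra k M) = c :=
        initialForm_of_forall_eq fun u hu v hv => by rw [c.2 u hu, c.2 v hv]
      rw [← hhom]
      exact initialForm_mem_initialIdeal φ hc
  · intro h
    rw [← h]
    exact Ideal.homogeneous_span (gradeBy k φ) _
      (by rintro _ ⟨f, -, rfl⟩; exact isHomogeneousElem_initialForm φ f)
end Bridge

/-! ### The link ideal: restriction of a Laurent ideal to a sublattice of exponents -/

section Link

variable {k : Type u} [CommSemiring k] {L : Type v} {M : Type w} [AddMonoid L] [AddMonoid M]

/-- The **link ideal** of `J ⊆ k[M]` along a map of exponent lattices `ι : L →+ M`: the pull-back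
`k[ι]⁻¹(J)` of `J` along the ring map `k[ι] : k[L] → k[M]`, `x^u ↦ x^{ι u}`; for `ι` the inclusion
of a sublattice this is `J ∩ k[L]`. Geometrically (`k` a field, `M ≅ ℤ^N`, `ι` injective with
saturated image, so that `T_L = Spec k[L]` is the QUOTIENT torus of `T = Spec k[M]` by the subtorus
`T' = Spec k[M/ι L]`): `V(linkIdeal ι J) ⊆ T_L` is the closed image of `V(J)` under `T → T/T'`;
when `V(J)` is `T'`-invariant it is the quotient `V(J)/T'`, and, in a splitting `M ≅ L' × L`,
`V(J) ≅ T' × V(linkIdeal ι J)` (`quotientEquivOfIsHomogeneous`, `quotientEquivTropicalLink`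
below). Applied to an initial ideal `J = in_w(I)` and the
sublattice `L = σ^⊥` of exponents orthogonal to the Gröbner cone `σ ∋ w`, `V(linkIdeal ι (in_w I))`
is the variety `Y_σ` with `in_w V(I) ≅ T_σ × Y_σ` — the "link" of route TropicalLinks.
[cite: Tevelev2007, §1, p. 1088 (`X ≃ (X/T_X) × T_X`)]; [folklore] as an operation on ideals. -/
def linkIdeal (ι : L →+ M) (J : Ideal (AddMonoidAlgebra k M)) : Ideal (AddMonoidAlgebra k L) :=
  J.comap (mapDomainRingHom k ι)

/-- Membership in the link ideal: `g ∈ linkIdeal ι J ↔ k[ι](g) ∈ J`. [folklore] -/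
theorem mem_linkIdeal_iff (ι : L →+ M) (J : Ideal (AddMonoidAlgebra k M))
    (g : AddMonoidAlgebra k L) :
    g ∈ linkIdeal ι J ↔ mapDomain ι g ∈ J :=
  Iff.rfl

/-- `linkIdeal ι` is monotone. [folklore] -/
theorem linkIdeal_mono (ι : L →+ M) {J J' : Ideal (AddMonoidAlgebra k M)} (h : J ≤ J') :
    linkIdeal ι J ≤ linkIdeal ι J' :=
  Ideal.comap_mono h

/-- The link of the unit ideal (empty subscheme) is the unit ideal. [folklore] -/
@[simp] theorem linkIdeal_top (ι : L →+ M) : linkIdeal ι (⊤ : Ideal (AddMonoidAlgebra k M)) = ⊤ :=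
  Ideal.comap_top

/-- The link of a proper ideal is proper (the image of a nonempty scheme is nonempty). [folklore] -/
theorem linkIdeal_ne_top (ι : L →+ M) {J : Ideal (AddMonoidAlgebra k M)} (hJ : J ≠ ⊤) :
    linkIdeal ι J ≠ ⊤ :=
  Ideal.comap_ne_top _ hJ

/-- The link of a prime ideal is prime (the closed image of an integral scheme is integral).
[folklore] -/
instance linkIdeal_isPrime (ι : L →+ M) (J : Ideal (AddMonoidAlgebra k M)) [J.IsPrime] :
    (linkIdeal ι J).IsPrime :=
  Ideal.comap_isPrime _ _

/-- The extension of the link ideal back to `k[M]` is contained in `J`. [folklore] -/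
theorem map_linkIdeal_le (ι : L →+ M) (J : Ideal (AddMonoidAlgebra k M)) :
    (linkIdeal ι J).map (mapDomainRingHom k ι) ≤ J :=
  Ideal.map_comap_le

end Link

/-! ### The torus-factor splitting on a split torus `T = T' × T_L`, `M = L' × L` -/

section Split

variable {k : Type u} [CommSemiring k] {L' : Type v} {L : Type w} [AddCommGroup L'] [AddCommGroup L]

/-- An element of `k[L' × L]` all of whose exponents have first component `0` comes from `k[L]`:
it is `k[inr]` of its projection to `k[L]`. [folklore] -/
theorem mapDomain_inr_mapDomain_snd_of_mem_gradeBy_zero {x : AddMonoidAlgebra k (L' × L)}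
    (hx : x ∈ gradeBy k (AddMonoidHom.fst L' L) 0) :
    mapDomain (AddMonoidHom.inr L' L) (mapDomain (AddMonoidHom.snd L' L) x) = x := by
  apply coeff_injective
  rw [coeff_mapDomain, coeff_mapDomain, ← Finsupp.mapDomain_comp]
  conv_rhs => rw [← Finsupp.mapDomain_id (v := x.coeff)]
  refine Finsupp.mapDomain_congr fun p hp => ?_
  have h1 : p.1 = 0 := hx p hp
  ext
  · simp [h1]
  · simp

/-- Untwisting a homogeneous element: if all exponents of `c` have first component `a`, then all
exponents of `x^{(-a,0)} c` have first component `0`. [folklore] -/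
theorem single_neg_mul_mem_gradeBy_zero {c : AddMonoidAlgebra k (L' × L)} {a : L'}
    (hc : c ∈ gradeBy k (AddMonoidHom.fst L' L) a) :
    single ((-a, 0) : L' × L) (1 : k) * c ∈ gradeBy k (AddMonoidHom.fst L' L) 0 := by
  have h1 : single ((-a, 0) : L' × L) (1 : k) ∈ gradeBy k (AddMonoidHom.fst L' L) (-a) := by
    simpa using single_mem_gradeBy (R := k) (AddMonoidHom.fst L' L) ((-a, 0) : L' × L) (1 : k)
  simpa using SetLike.mul_mem_graded h1 hc

/-- **Normal form of a homogeneous element on a split torus**: if all exponents of `c ∈ k[L' × L]`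
have first component `a`, then `c = x^{(a,0)} · k[inr](c₀)` with
`c₀ = k[snd](x^{(-a,0)} c) ∈ k[L]`. [folklore] -/
theorem eq_single_mul_mapDomain_inr_of_mem_gradeBy {c : AddMonoidAlgebra k (L' × L)} {a : L'}
    (hc : c ∈ gradeBy k (AddMonoidHom.fst L' L) a) :
    c = single ((a, 0) : L' × L) (1 : k) *
      mapDomain (AddMonoidHom.inr L' L)
        (mapDomain (AddMonoidHom.snd L' L) (single ((-a, 0) : L' × L) (1 : k) * c)) := by
  have h1 : single ((a, 0) : L' × L) (1 : k) * single ((-a, 0) : L' × L) (1 : k) = 1 := by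
    rw [single_mul_single, AddMonoidAlgebra.one_def, mul_one, Prod.mk_add_mk, add_neg_cancel,
      add_zero, Prod.mk_zero_zero]
  rw [mapDomain_inr_mapDomain_snd_of_mem_gradeBy_zero (single_neg_mul_mem_gradeBy_zero hc),
    ← mul_assoc, h1, one_mul]

variable [DecidableEq L']

/-- **Torus-factor splitting, ideal form.** Let `J ⊆ k[L' × L]` be homogeneous for the
`L'`-grading by the first component of exponents (i.e. `V(J) ⊆ T' × T_L` is invariant under the
subtorus `T' = Spec k[L']`). Then `J` is generated by its link ideal `J ∩ k[L]`:
`J = k[inr](linkIdeal inr J) · k[L' × L]`. [cite: Tevelev2007, §1, p. 1088]; [folklore]. -/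
theorem map_linkIdeal_inr_eq (J : Ideal (AddMonoidAlgebra k (L' × L)))
    (hJ : J.IsHomogeneous (gradeBy k (AddMonoidHom.fst L' L))) :
    (linkIdeal (AddMonoidHom.inr L' L) J).map (mapDomainRingHom k (AddMonoidHom.inr L' L)) = J := by
  classical
  refine le_antisymm (map_linkIdeal_le _ _) fun f hf => ?_
  rw [← DirectSum.sum_support_decompose (gradeBy k (AddMonoidHom.fst L' L)) f]
  refine Ideal.sum_mem _ fun a _ => ?_
  set c : gradeBy k (AddMonoidHom.fst L' L) a := decompose (gradeBy k (AddMonoidHom.fst L' L)) f a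
  have hcJ : (c : AddMonoidAlgebra k (L' × L)) ∈ J := hJ a hf
  rw [eq_single_mul_mapDomain_inr_of_mem_gradeBy c.2]
  refine Ideal.mul_mem_left _ _ (Ideal.mem_map_of_mem _ ?_)
  rw [mem_linkIdeal_iff,
    mapDomain_inr_mapDomain_snd_of_mem_gradeBy_zero (single_neg_mul_mem_gradeBy_zero c.2)]
  exact Ideal.mul_mem_left _ _ hcJ

/-- Conversely, an ideal generated by elements of `k[L]` is homogeneous for the `L'`-grading.
[folklore] -/
theorem isHomogeneous_map_mapDomainRingHom_inr (J₀ : Ideal (AddMonoidAlgebra k L)) :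
    (J₀.map (mapDomainRingHom k (AddMonoidHom.inr L' L))).IsHomogeneous
      (gradeBy k (AddMonoidHom.fst L' L)) := by
  classical
  unfold Ideal.map
  refine Ideal.homogeneous_span (gradeBy k (AddMonoidHom.fst L' L)) _ ?_
  rintro _ ⟨g, -, rfl⟩
  refine ⟨0, fun p hp => ?_⟩
  rw [mapDomainRingHom_apply, coeff_mapDomain] at hp
  obtain ⟨u, -, rfl⟩ := Finset.mem_image.1 (Finsupp.mapDomain_support hp)
  rfl

end Split

/-! ### The torus-factor splitting as an isomorphism of coordinate rings -/

section Quotient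

variable {k : Type u} [CommRing k] {L' : Type v} {L : Type w} [AddCommGroup L'] [AddCommGroup L]

/-- The comparison map `k[L' × L] → (k[L] ⧸ linkIdeal inr J)[L']`: write a Laurent polynomial in
`(x, y)` as a Laurent polynomial in `x` with coefficients in `k[y^±]`, and reduce the coefficients
modulo the link ideal. [folklore] -/
def splitQuotientMap (J : Ideal (AddMonoidAlgebra k (L' × L))) :
    AddMonoidAlgebra k (L' × L) →ₐ[k]
      AddMonoidAlgebra (AddMonoidAlgebra k L ⧸ linkIdeal (AddMonoidHom.inr L' L) J) L' :=
  (mapAlgHom L' (Ideal.Quotient.mkₐ k (linkIdeal (AddMonoidHom.inr L' L) J))).comp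
    (curryAlgEquiv k : AddMonoidAlgebra k (L' × L) ≃ₐ[k] AddMonoidAlgebra (AddMonoidAlgebra k L) L')

/-- Currying an element of `k[L] ⊆ k[L' × L]` gives a constant. [folklore] -/
theorem curryAlgEquiv_mapDomain_inr (g : AddMonoidAlgebra k L) :
    (curryAlgEquiv k : AddMonoidAlgebra k (L' × L) ≃ₐ[k] AddMonoidAlgebra (AddMonoidAlgebra k L) L')
        (mapDomain (AddMonoidHom.inr L' L) g) =
      single (0 : L') g := by
  induction g using AddMonoidAlgebra.induction_linear with
  | zero => rw [mapDomain_zero, map_zero, single_zero]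
  | add x y hx hy => rw [mapDomain_add, map_add, hx, hy, single_add]
  | single u r => rw [mapDomain_single, AddMonoidHom.inr_apply, curryAlgEquiv_single]

/-- Uncurrying a monomial `x^a · g(y)`: it is `x^{(a,0)} · k[inr](g)`. [folklore] -/
theorem curryAlgEquiv_symm_single_eq (a : L') (g : AddMonoidAlgebra k L) :
    (curryAlgEquiv k : AddMonoidAlgebra k (L' × L) ≃ₐ[k]
        AddMonoidAlgebra (AddMonoidAlgebra k L) L').symm (single a g) =
      single ((a, 0) : L' × L) (1 : k) * mapDomain (AddMonoidHom.inr L' L) g := by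
  induction g using AddMonoidAlgebra.induction_linear with
  | zero => rw [single_zero, map_zero, mapDomain_zero, mul_zero]
  | add x y hx hy => rw [single_add, map_add, hx, hy, mapDomain_add, mul_add]
  | single u r =>
    rw [AddMonoidAlgebra.curryAlgEquiv_symm_single, mapDomain_single, AddMonoidHom.inr_apply,
      single_mul_single, one_mul, Prod.mk_add_mk, add_zero, zero_add]

/-- The comparison map on monomials: `x^a y^u ↦ [y^u] x^a`. [folklore] -/
@[simp] theorem splitQuotientMap_single (J : Ideal (AddMonoidAlgebra k (L' × L))) (a : L') (u : L)
    (r : k) :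
    splitQuotientMap J (single (a, u) r) =
      single a (Ideal.Quotient.mk (linkIdeal (AddMonoidHom.inr L' L) J) (single u r)) := by
  simp [splitQuotientMap]

/-- The comparison map is surjective. [folklore] -/
theorem splitQuotientMap_surjective (J : Ideal (AddMonoidAlgebra k (L' × L))) :
    Function.Surjective (splitQuotientMap J) := by
  intro y
  induction y using AddMonoidAlgebra.induction_linear with
  | zero => exact ⟨0, map_zero _⟩
  | add x y hx hy =>
    obtain ⟨a, rfl⟩ := hx
    obtain ⟨b, rfl⟩ := hy
    exact ⟨a + b, map_add _ _ _⟩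
  | single a q =>
    obtain ⟨g, rfl⟩ := Ideal.Quotient.mk_surjective q
    refine ⟨(curryAlgEquiv k : AddMonoidAlgebra k (L' × L) ≃ₐ[k]
      AddMonoidAlgebra (AddMonoidAlgebra k L) L').symm (single a g), ?_⟩
    simp [splitQuotientMap]

/-- The comparison map kills `k[inr]` of the link ideal. [folklore] -/
theorem splitQuotientMap_mapDomain_inr_of_mem (J : Ideal (AddMonoidAlgebra k (L' × L)))
    {g : AddMonoidAlgebra k L} (hg : g ∈ linkIdeal (AddMonoidHom.inr L' L) J) :
    splitQuotientMap J (mapDomain (AddMonoidHom.inr L' L) g) = 0 := by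
  rw [splitQuotientMap, AlgHom.comp_apply, AlgEquiv.coe_toAlgHom, curryAlgEquiv_mapDomain_inr,
    mapAlgHom_single, Ideal.Quotient.mkₐ_eq_mk, Ideal.Quotient.eq_zero_iff_mem.2 hg, single_zero]

variable [DecidableEq L']

/-- **The kernel of the comparison map is `J`** when `J` is homogeneous for the `L'`-grading.
[folklore] -/
theorem ker_splitQuotientMap (J : Ideal (AddMonoidAlgebra k (L' × L)))
    (hJ : J.IsHomogeneous (gradeBy k (AddMonoidHom.fst L' L))) :
    RingHom.ker (splitQuotientMap J) = J := by
  classical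
  apply le_antisymm
  · intro f hf
    rw [RingHom.mem_ker] at hf
    set F : AddMonoidAlgebra (AddMonoidAlgebra k L) L' :=
      (curryAlgEquiv k : AddMonoidAlgebra k (L' × L) ≃ₐ[k]
        AddMonoidAlgebra (AddMonoidAlgebra k L) L') f with hF
    have hcoeff : ∀ a, mapDomain (AddMonoidHom.inr L' L) (F.coeff a) ∈ J := by
      intro a
      have h1 : (splitQuotientMap J f).coeff a = 0 := by rw [hf, coeff_zero, Finsupp.zero_apply]
      have h2 : (splitQuotientMap J f).coeff a =
          Ideal.Quotient.mk (linkIdeal (AddMonoidHom.inr L' L) J) (F.coeff a) := by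
        rw [splitQuotientMap, AlgHom.comp_apply, AlgEquiv.coe_toAlgHom, coeff_mapAlgHom,
          Ideal.Quotient.mkₐ_eq_mk]
      rw [h2, Ideal.Quotient.eq_zero_iff_mem, mem_linkIdeal_iff] at h1
      exact h1
    have hfF : f = (curryAlgEquiv k : AddMonoidAlgebra k (L' × L) ≃ₐ[k]
        AddMonoidAlgebra (AddMonoidAlgebra k L) L').symm F := by
      rw [hF, AlgEquiv.symm_apply_apply]
    rw [hfF, ← sum_coeff_single F, map_finsuppSum, Finsupp.sum]
    refine Ideal.sum_mem _ fun a _ => ?_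
    rw [curryAlgEquiv_symm_single_eq]
    exact Ideal.mul_mem_left _ _ (hcoeff a)
  · refine (map_linkIdeal_inr_eq J hJ).symm.trans_le ?_
    rw [Ideal.map_le_iff_le_comap]
    intro g hg
    rw [Ideal.mem_comap, RingHom.mem_ker, mapDomainRingHom_apply]
    exact splitQuotientMap_mapDomain_inr_of_mem J hg

/-- **Torus-factor splitting (coordinate rings).** For an ideal `J ⊆ k[L' × L] = k[x^±, y^±]`
homogeneous for the `L'`-grading (= `V(J) ⊆ T' × T_L` invariant under the subtorus
`T' = Spec k[L']`), the coordinate ring of `V(J)` is the LAURENT POLYNOMIAL RING over the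
coordinate ring of the link `Y = V(linkIdeal inr J) ⊆ T_L`:
`k[L' × L] ⧸ J ≃ₐ[k] (k[L] ⧸ linkIdeal inr J)[L']`, i.e. `V(J) ≅ T' × Y`.
[cite: Tevelev2007, §1, p. 1088 (`X ≃ (X/T_X) × T_X`)]; [folklore]. -/
def quotientEquivOfIsHomogeneous (J : Ideal (AddMonoidAlgebra k (L' × L)))
    (hJ : J.IsHomogeneous (gradeBy k (AddMonoidHom.fst L' L))) :
    (AddMonoidAlgebra k (L' × L) ⧸ J) ≃ₐ[k]
      AddMonoidAlgebra (AddMonoidAlgebra k L ⧸ linkIdeal (AddMonoidHom.inr L' L) J) L' :=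
  (Ideal.quotientEquivAlgOfEq k (ker_splitQuotientMap J hJ).symm).trans
    (Ideal.quotientKerAlgEquivOfSurjective (splitQuotientMap_surjective J))

/-- The splitting isomorphism on residue classes is the comparison map. [folklore] -/
@[simp] theorem quotientEquivOfIsHomogeneous_mk (J : Ideal (AddMonoidAlgebra k (L' × L)))
    (hJ : J.IsHomogeneous (gradeBy k (AddMonoidHom.fst L' L))) (f : AddMonoidAlgebra k (L' × L)) :
    quotientEquivOfIsHomogeneous J hJ (Ideal.Quotient.mk J f) = splitQuotientMap J f := by
  simp [quotientEquivOfIsHomogeneous]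

end Quotient

/-! ### Transport along a change of coordinates `e : M ≃+ L' × L` (a splitting of the lattice) -/

section Transport

variable {k : Type u} [CommSemiring k] {M : Type v} {M' : Type w} [AddMonoid M] [AddMonoid M']
  {Λ : Type*} [AddMonoid Λ]

/-- Weight-graded pieces under a monomial change of coordinates. [folklore] -/
theorem domCongr_mem_gradeBy_iff (e : M ≃+ M') (φ : M' →+ Λ) (i : Λ) (x : AddMonoidAlgebra k M) :
    domCongr k k e x ∈ gradeBy k φ i ↔ x ∈ gradeBy k (φ.comp e.toAddMonoidHom) i := by
  rw [mem_gradeBy_iff_forall, mem_gradeBy_iff_forall]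
  constructor
  · intro h m hm
    have h1 : e m ∈ (domCongr k k e x).coeff.support := by
      rw [Finsupp.mem_support_iff, coeff_domCongr, AddEquiv.symm_apply_apply]
      exact Finsupp.mem_support_iff.1 hm
    simpa using h (e m) h1
  · intro h n hn
    have h1 : e.symm n ∈ x.coeff.support := by
      rw [Finsupp.mem_support_iff, coeff_domCongr] at hn
      exact Finsupp.mem_support_iff.2 hn
    simpa using h (e.symm n) h1

variable [DecidableEq Λ]

/-- Homogeneous components commute with a monomial change of coordinates. [folklore] -/
theorem domCongr_symm_filter (e : M ≃+ M') (φ : M' →+ Λ) (i : Λ) (y : AddMonoidAlgebra k M') :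
    (domCongr k k e).symm (ofCoeff (y.coeff.filter fun n => φ n = i)) =
      ofCoeff (((domCongr k k e).symm y).coeff.filter
        fun m => (φ.comp e.toAddMonoidHom) m = i) := by
  apply coeff_injective
  ext m
  simp only [domCongr_symm, coeff_domCongr, Finsupp.filter_apply, AddMonoidHom.comp_apply,
    AddEquiv.coe_toAddMonoidHom, AddEquiv.symm_symm]

/-- Membership in the image of an ideal under a monomial change of coordinates. [folklore] -/
theorem mem_map_domCongr_iff (e : M ≃+ M') (J : Ideal (AddMonoidAlgebra k M))
    (y : AddMonoidAlgebra k M') :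
    y ∈ J.map (domCongr k k e) ↔ (domCongr k k e).symm y ∈ J := by
  rw [Ideal.mem_map_of_equiv]
  constructor
  · rintro ⟨x, hx, rfl⟩
    rwa [AlgEquiv.symm_apply_apply]
  · intro h
    exact ⟨_, h, (domCongr k k e).apply_symm_apply y⟩

/-- **Homogeneity is transported by a change of coordinates**: `J ⊆ k[M]` is homogeneous for the
weight map `φ ∘ e` iff its image in `k[M']` under the monomial isomorphism `k[e]` is homogeneous
for `φ`. [folklore] -/
theorem isHomogeneous_map_domCongr (e : M ≃+ M') (φ : M' →+ Λ) {J : Ideal (AddMonoidAlgebra k M)}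
    (hJ : J.IsHomogeneous (gradeBy k (φ.comp e.toAddMonoidHom))) :
    (J.map (domCongr k k e)).IsHomogeneous (gradeBy k φ) := by
  intro i y hy
  rw [mem_map_domCongr_iff] at hy ⊢
  rw [decompose_gradeBy_coe, domCongr_symm_filter]
  have := hJ i hy
  rw [decompose_gradeBy_coe] at this
  exact this

end Transport

/-! ### The tropical link of an ideal with respect to a splitting of the exponent lattice -/

section TropicalLink

variable {k : Type u} [CommRing k] {M : Type v} [AddCommGroup M] {L' : Type w} {L : Type*}
  [AddCommGroup L'] [AddCommGroup L]

/-- The **link ideal with respect to a splitting** `e : M ≃+ L' × L` of the exponent lattice: the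
ideal `k[e](J) ∩ k[L]` of `k[L]`. For `J = in_w(I)` an initial ideal of `I ⊆ k[ℤ^N]`, `σ` the cone
of the Gröbner fan with `w ∈ relint σ`, and `e ∈ GL_N(ℤ)` a splitting `ℤ^N ≅ ℤ^r × ℤ^{N-r}` whose
second factor is `σ^⊥ ∩ ℤ^N` (so that `in_w(I)` is homogeneous for the first factor), this is the
ideal of `Y_σ ⊆ 𝔾_m^{N-r}` with `in_w V(I) ≅ T_σ × Y_σ` (`quotientEquivTropicalLink`). [folklore] -/
def splitLinkIdeal (e : M ≃+ L' × L) (J : Ideal (AddMonoidAlgebra k M)) :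
    Ideal (AddMonoidAlgebra k L) :=
  linkIdeal (AddMonoidHom.inr L' L) (J.map (domCongr k k e))

/-- Membership in the link ideal of a splitting: `g(y) ∈ splitLinkIdeal e J ↔ g(x^{e⁻¹(0,·)}) ∈ J`.
[folklore] -/
theorem mem_splitLinkIdeal_iff (e : M ≃+ L' × L) (J : Ideal (AddMonoidAlgebra k M))
    (g : AddMonoidAlgebra k L) :
    g ∈ splitLinkIdeal e J ↔
      mapDomain (e.symm.toAddMonoidHom.comp (AddMonoidHom.inr L' L)) g ∈ J := by
  rw [splitLinkIdeal, mem_linkIdeal_iff, mem_map_domCongr_iff, domCongr_symm]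
  have : (domCongr k k e.symm) (mapDomain (AddMonoidHom.inr L' L) g) =
      mapDomain (e.symm.toAddMonoidHom.comp (AddMonoidHom.inr L' L)) g := by
    apply coeff_injective
    rw [coeff_mapDomain, AddMonoidHom.coe_comp, Finsupp.mapDomain_comp, ← coeff_mapDomain,
      ← coeff_mapDomain]
    rfl
  rw [this]

/-- The link ideal of a splitting is the link ideal along the lattice map `u ↦ e⁻¹(0, u)`.
[folklore] -/
theorem splitLinkIdeal_eq_linkIdeal (e : M ≃+ L' × L) (J : Ideal (AddMonoidAlgebra k M)) :
    splitLinkIdeal e J = linkIdeal (e.symm.toAddMonoidHom.comp (AddMonoidHom.inr L' L)) J := by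
  ext g
  rw [mem_splitLinkIdeal_iff, mem_linkIdeal_iff]

/-- The **tropical link** (coordinate ring): `k[L] ⧸ splitLinkIdeal e J`, the coordinate ring of
`Y = V(J)/T'` in the coordinates of the splitting `e`. For `J = in_w(I)` and `e` adapted to the
Gröbner cone `σ ∋ w` this is `𝒪(Y_σ)`, the "link" of route `TropicalLinks`, with
`𝒪(in_w V(I)) ≅ 𝒪(Y_σ)[x_1^±, …, x_r^±]` (`quotientEquivTropicalLink`). [folklore] -/
abbrev TropicalLink (e : M ≃+ L' × L) (J : Ideal (AddMonoidAlgebra k M)) : Type _ :=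
  AddMonoidAlgebra k L ⧸ splitLinkIdeal e J

variable [DecidableEq L']

/-- **Torus-factor splitting for a split sublattice.** If `J ⊆ k[M]` is homogeneous for the
weight map `fst ∘ e : M → L'` of a splitting `e : M ≃+ L' × L` (i.e. `V(J)` is invariant under the
subtorus `T' ⊆ T = Spec k[M]` with character lattice `L'`), then
`k[M] ⧸ J ≃ₐ[k] (TropicalLink e J)[L']`: `V(J) ≅ T' × Y`, `Y = Spec (TropicalLink e J)`.
[cite: Tevelev2007, §1, p. 1088]; [folklore]. -/
def quotientEquivTropicalLink (e : M ≃+ L' × L) (J : Ideal (AddMonoidAlgebra k M))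
    (hJ : J.IsHomogeneous (gradeBy k ((AddMonoidHom.fst L' L).comp e.toAddMonoidHom))) :
    (AddMonoidAlgebra k M ⧸ J) ≃ₐ[k] AddMonoidAlgebra (TropicalLink e J) L' :=
  (Ideal.quotientEquivAlg J (J.map (domCongr k k e)) (domCongr k k e) rfl).trans
    (quotientEquivOfIsHomogeneous _ (isHomogeneous_map_domCongr e (AddMonoidHom.fst L' L) hJ))

end TropicalLink

/-! ### Integer weights on `k[x_1^±, …, x_N^±]`: the homogeneity lattice of an ideal -/

section Weights

variable {k : Type u} [CommSemiring k] {N : ℕ}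

/-- The weight functional `⟨w, ·⟩ : ℤ^N →+ ℤ` of `w ∈ ℤ^N` as an additive monoid hom
(`⇑(dotWeightHom w) = dotWeight w` by `rfl`). [folklore] -/
def dotWeightHom (w : Fin N → ℤ) : (Fin N → ℤ) →+ ℤ where
  toFun := dotWeight w
  map_zero' := by simp [dotWeight]
  map_add' := dotWeight_add w

/-- `⇑(dotWeightHom w) = dotWeight w`. [folklore] -/
@[simp] theorem coe_dotWeightHom (w : Fin N → ℤ) : ⇑(dotWeightHom w) = dotWeight w := rfl

/-- `w ↦ ⟨w, ·⟩` is additive. [folklore] -/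
theorem dotWeightHom_add (w₁ w₂ : Fin N → ℤ) :
    dotWeightHom (w₁ + w₂) = dotWeightHom w₁ + dotWeightHom w₂ :=
  AddMonoidHom.ext fun v => by simp [dotWeight, add_mul, Finset.sum_add_distrib]

/-- `⟨-w, ·⟩ = -⟨w, ·⟩`. [folklore] -/
theorem dotWeightHom_neg (w : Fin N → ℤ) : dotWeightHom (-w) = -dotWeightHom w :=
  AddMonoidHom.ext fun v => by simp [dotWeight, Finset.sum_neg_distrib]

/-- **`in_w(J) = J` iff `J` is homogeneous for the `ℤ`-grading `deg x^v = ⟨w, v⟩`** (iff `V(J)` is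
invariant under the one-parameter subgroup `t ↦ (t^{w_1}, …, t^{w_N})` of `𝔾_m^N`). [folklore] -/
theorem weightInitialIdeal_eq_self_iff (w : Fin N → ℤ)
    (J : Ideal (AddMonoidAlgebra k (Fin N → ℤ))) :
    weightInitialIdeal w J = J ↔ J.IsHomogeneous (gradeBy k (dotWeightHom w)) :=
  (isHomogeneous_gradeBy_iff_initialIdeal_eq (dotWeightHom w) J).symm

/-- The **homogeneity lattice** of an ideal `J ⊆ k[x_1^±, …, x_N^±]`: the integer weights `w'`
with `in_{w'}(J) = J`, i.e. the cocharacters of the largest subtorus of `𝔾_m^N` leaving `V(J)`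
invariant. For `J = in_w(I)` with `w` in the relative interior of a cone `σ` of the Gröbner fan of
`I` this is `span(σ) ∩ ℤ^N`, of rank `dim σ` (by the lemma `in_u(in_w I) = in_{w+εu} I` of
[cite: Katz2009TropicalToolkit, §5]; that identification is NOT proved here). [folklore] -/
def homogeneityLattice (J : Ideal (AddMonoidAlgebra k (Fin N → ℤ))) : AddSubgroup (Fin N → ℤ) where
  carrier := {w | weightInitialIdeal w J = J}
  zero_mem' := weightInitialIdeal_zero J
  add_mem' {w₁ w₂} h₁ h₂ := by
    have h₁' := (weightInitialIdeal_eq_self_iff w₁ J).1 h₁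
    have h₂' := (weightInitialIdeal_eq_self_iff w₂ J).1 h₂
    refine (weightInitialIdeal_eq_self_iff (w₁ + w₂) J).2 ?_
    rw [dotWeightHom_add, show dotWeightHom w₁ + dotWeightHom w₂ =
      (AddMonoidHom.fst ℤ ℤ + AddMonoidHom.snd ℤ ℤ).comp ((dotWeightHom w₁).prod (dotWeightHom w₂))
      from AddMonoidHom.ext fun v => by simp]
    exact isHomogeneous_gradeBy_comp (isHomogeneous_gradeBy_prod h₁' h₂') _
  neg_mem' {w} h := by
    have h' := (weightInitialIdeal_eq_self_iff w J).1 h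
    refine (weightInitialIdeal_eq_self_iff (-w) J).2 ?_
    rw [dotWeightHom_neg, show -dotWeightHom w = (-AddMonoidHom.id ℤ).comp (dotWeightHom w) from
      AddMonoidHom.ext fun v => by simp]
    exact isHomogeneous_gradeBy_comp h' _

/-- Membership in the homogeneity lattice. [folklore] -/
theorem mem_homogeneityLattice_iff (J : Ideal (AddMonoidAlgebra k (Fin N → ℤ))) (w : Fin N → ℤ) :
    w ∈ homogeneityLattice J ↔ weightInitialIdeal w J = J :=
  Iff.rfl

/-- **Joint homogeneity for integer weights**: if `in_{w_i}(J) = J` for finitely many weights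
`w_i`, then `J` is homogeneous for the joint `ℤ^r`-grading `v ↦ (⟨w_i, v⟩)_i` — the hypothesis of
the torus-factor splitting `quotientEquivTropicalLink` for a change of coordinates `e ∈ GL_N(ℤ)`
whose first `r` rows are the `w_i`. [folklore] -/
theorem isHomogeneous_gradeBy_pi_of_forall_weightInitialIdeal_eq {r : ℕ} (w : Fin r → Fin N → ℤ)
    {J : Ideal (AddMonoidAlgebra k (Fin N → ℤ))} (h : ∀ i, weightInitialIdeal (w i) J = J) :
    J.IsHomogeneous (gradeBy k (AddMonoidHom.pi fun i => dotWeightHom (w i))) :=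
  isHomogeneous_gradeBy_of_forall_eval _ fun i => by
    have := (weightInitialIdeal_eq_self_iff (w i) J).1 (h i)
    exact this

/-- **Entry point for the route.** Let `e : ℤ^N ≃ ℤ^r × L` be a change of coordinates whose first
`r` coordinate functionals are the weights `w_i` (`(e v).1 i = ⟨w_i, v⟩`), and suppose
`in_{w_i}(J) = J` for all `i` (e.g. `J = in_w(I)` and `w_i ∈ span(σ) ∩ ℤ^N`, `w ∈ relint σ`). Then
`J` is homogeneous for `fst ∘ e`, which is the hypothesis of the torus-factor splitting
`quotientEquivTropicalLink e J : k[ℤ^N] ⧸ J ≃ₐ[k] (TropicalLink e J)[ℤ^r]`. [folklore] -/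
theorem isHomogeneous_fst_comp_of_forall_weightInitialIdeal_eq {r : ℕ} {L : Type*}
    [AddCommGroup L] (e : (Fin N → ℤ) ≃+ (Fin r → ℤ) × L) (w : Fin r → Fin N → ℤ)
    (he : ∀ v i, (e v).1 i = dotWeight (w i) v) {J : Ideal (AddMonoidAlgebra k (Fin N → ℤ))}
    (h : ∀ i, weightInitialIdeal (w i) J = J) :
    J.IsHomogeneous (gradeBy k ((AddMonoidHom.fst (Fin r → ℤ) L).comp e.toAddMonoidHom)) := by
  have hEq : (AddMonoidHom.fst (Fin r → ℤ) L).comp e.toAddMonoidHom =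
      AddMonoidHom.pi fun i => dotWeightHom (w i) :=
    AddMonoidHom.ext fun v => funext fun i => by simpa using he v i
  rw [hEq]
  exact isHomogeneous_gradeBy_pi_of_forall_weightInitialIdeal_eq w h

end Weights

end Literature.AlgebraicGeometry.Tropical

end
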